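import Mathlib
import HarnessLib
import HarnessLib.Audit
import Summits.NavierStokesRegularity.Statement
import Literature.Analysis.FluidPDE.ClassicalSolution
import Literature.Analysis.FluidPDE.LerayHopf
import Literature.Analysis.FluidPDE.SelfSimilar
import Literature.Analysis.FluidPDE.NSWave0
import Summits.NavierStokesRegularity.NavierStokesRegularity.Theorems.AdiabaticEddyClayUniqueness
import HarnessLib.Audit.Status.Attr

/-!
Route: QuarterTurnRdss

Route QuarterTurnRdss — NavierStokesRegularity, NEGATIVE side, two-sided filing; realises idea card
quarter-turn-rdss-funnel.
X ("it suffices to exhibit"): there are λ > 1 and a NONTRIVIAL ancient mild solution u of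
Navier–Stokes (ν = 1) on ℝ³ × (−∞,0), measurable slices, Type-I bound |u(t,x)| ≤ C₀/(|x| + √−t),
which is ROTATED discretely self-similar with factor λ and the quarter-turn R about the x₃-axis, λ
Rᵀ u(λ²t, λRx) = u(t,x) (R pinned by coordinates: (Rx)₀ = −x₁, (Rx)₁ = x₀, (Rx)₂ = x₂; R⁴ = 1, so u
is also λ⁴-DSS), and GENUINELY TWISTED (its slices are not all a.e. R-equivariant, equivalently u is
not λ-DSS). In Leray variables this is a Type-I "breather" U(y,s) with U(·, s + 2 log λ) = Rᵀ U(R·,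
s): the symmetry class of the perpendicular (pair → sheet → perpendicular pair) vortex cascade seen
in experiments/DNS (MckeownEtAl2020, BrennerHormozPumir2016), i.e. (α,λ)-RDSS with resonant phase 2α
log λ = π/2 (BradshawTsai2017CPDE §1; PineauVicol2026 §1.4).
Lean: QuarterTurnProfileExists := ∃ c : ℝ, 1 < c ∧ ∃ R : EuclideanSpace ℝ (Fin 3) ≃ₗᵢ[ℝ]
EuclideanSpace ℝ (Fin 3), (∀ x, (R x) 0 = -(x 1) ∧ (R x) 1 = x 0 ∧ (R x) 2 = x 2) ∧ ∃ u,
Literature.Analysis.FluidPDE.IsAncientMildSolution 1 u ∧ (∀ t < 0, AEStronglyMeasurable (u t)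
volume) ∧ Literature.Analysis.FluidPDE.IsRotatedDSS c R u ∧ (∃ C₀,
Literature.Analysis.FluidPDE.HasTypeIDecay C₀ u) ∧ ¬ (∀ t < 0, u t =ᵐ[volume] 0) ∧ ¬ (∀ t < 0, (fun
x => u t (R x)) =ᵐ[volume] fun x => R (u t x)).
Deciding theorem (D-0027 §2.1, NEGATIVE: concludes ¬NavierStokesRegularity; certified by the native
audit, axioms propext/Classical.choice/Quot.sound): closes : QuarterTurnProfileExists →
QuarterTurnRdssIsDss4 → DssProfileTruncation → ClayUniqueness → ¬NavierStokesRegularity. The profile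
(c,R,u) is c⁴-DSS because R⁴ = 1 (support QuarterTurnRdssIsDss4), hence a nontrivial plain-DSS
Type-I ancient mild solution with factor c⁴ > 1; the conjecture-free truncation bridge
DssProfileTruncation (stmt-NavierStokesRegularity-2459: such a profile ⇒ a rapidly decaying datum
whose Leray–Hopf classical solution has FINITE maximal lifespan, = X5a; a proved corollary of the
shared wall-form bridge stmt-NavierStokesRegularity-0901 of route DssFarFieldSlaving, evidence
V_ns2.lean) and Clay-class uniqueness ClayUniqueness (X5b, stmt-NavierStokesRegularity-0153, route
Blowup) then contradict Clay (A) exactly as in Literature.NS.blowup_assembly (inlined in the glue: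
(A) on the datum gives a global smooth bounded-energy solution, X5b glues it to the blowing-up one
on [0,T), its restriction to [0,T+1) extends past T). Route repair 2026-08-15: the wall-form bridge
DssTruncationBridge (stmt-0901) and the old inlined Assembly item (stmt-1105) are no longer items of
THIS route — they carried the conjecture constant
Literature.Analysis.FluidPDE.TypeIDSSLiouvilleConjecture into the cone; the profile still refutes
that wall (evidence V_ns.lean, `profile_negates_wall`), but no item here mentions it.
Two-sided: the ¬-side crux QuarterTurnLiouville := ∀ c R, (quarter-turn R) → 1 < c → every ancient
mild (ν=1, measurable slices) (c,R)-RDSS solution with a Type-I bound vanishes a.e. on every slice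
(= Literature.Analysis.FluidPDE.RotatedTypeIDSSLiouville c R unfolded; Type-I RDSS Liouville in the
quarter-turn class; a special case of Tsai's Conj. 8.8–8.9 NOT covered by PineauVicol2026 Thm 1.7 at
moderate λ) is filed with its proposed mechanism, the card's CIRCULATION LEDGER (informal crux
CirculationLedgerFunnel): circulation is scaling-invariant, so every generation of an exact RDSS
cascade carries the same sectional circulation, while observed cascades split it (x_Γ ≈ 0.25 per
generation, MckeownEtAl2020 p.4) — only "funnels" can be self-similar, and funnels should be
axisymmetric-like, hence Type-I-excluded (SereginSverak2009, KNSS2009).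

Rationale: WHY THIS LINE. Route Blowup files the DSS profile half of a Type-I blow-up as crux #5
(¬TypeIDSSLiouvilleConjecture, scenario "NOT decomposed"); route DssFarFieldSlaving is the
truncation bridge and explicitly leaves "the SOURCE of H1 (O_h relay, quarter-turn RDSS, …)"
outside. This route names ONE source with a physical seed and a built-in selection rule (card
quarter-turn-rdss-funnel): the only iterative small-scale mechanism actually observed in 3D NS —
antiparallel pair → sheet → perpendicular secondary pairs → repeat (MckeownEtAl2020,
BrennerHormozPumir2016 Sec. VI iteration map eq.(19)–(25), YaoHussain2020) — has the exact NS
symmetry class "RDSS with quarter-turn monodromy": u = λRᵀu(λ²t, λR x), R⁴ = 1, i.e. (α,λ)-RDSS with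
resonant phase 2α log λ = π/2 (BradshawTsai2017CPDE §1: nφ = 2πm ⇒ λⁿ-DSS; PineauVicol2026 §1.4 and
Rmk 1.8: DSS/RDSS = "breathers", periodic modulo the symmetry group; the backward RSS ansatz is
Perelman's, BradshawTsai2017CPDE p.4). Imported areas: vortex-dynamics phenomenology (reconnection
cascade, Kelvin/Helmholtz circulation bookkeeping) with an explicit dictionary generation n ↦
s-interval [nS,(n+1)S), S = 2 log λ; structure circulation ↦ flux of curl U through meridional
half-annulus sections; perpendicular daughter ↦ monodromy R; and the dynamical-systems notion of a
relative periodic orbit with finite-order monodromy (the "twisted periodic orbit" of the Leray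
semiflow). The construction side is a finite-parameter target (λ, Γ_*/ν, quarter-turn) for
fixed-point/computer-assisted work; the ¬-side is a sharply delimited special case of Tsai2018 Conj.
8.8–8.9 that the newest Liouville technology misses: PineauVicol2026 Thm 1.7 removes (α,λ)-RDSS only
for |α| ≤ α̲(C₀), λ < λ̲, or |α| ≥ ᾱ(C₀), λ < λ̲^{1/(1+α²)}; for the quarter-turn class α = π/(4 log
λ), so (1+α²)log λ ≥ π²/(16 log λ) → ∞ as λ → 1⁺ and neither clause applies — what survives near λ =
1 is only the λ⁴-DSS embedding (ChaeWolf2017RemovingDSS Thm 1.3 / PineauVicol2026 Thm 1.6 with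
factor λ⁴ < λ_*(C₀)), filed as support NearIdentityRemoval. PineauVicol2026 p.5 also records the
rigidity endpoint the card's ledger aims at: large twist forces the profile toward the kernel of J −
(Jy)·∇ = AXISYMMETRIC fields, which are Type-I-excluded (SereginSverak2009; in-tree
Literature.Analysis.FluidPDE.knss_bound_C_over_r, KNSS2009 Thm 5.3).
RANKED CRUXES. #2 QuarterTurnProfileExists (typed; the construction; why it might fail: Tsai's
conjecture / KNSS (L) may hold — every Type-I RDSS profile is a Type-I singularity
(AlbrittonBarker2019); the measured cascades SPLIT circulation, x_Γ ≈ 0.25 per generation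
(MckeownEtAl2020 p.4), so the profile must be an unobserved "funnel"; PineauVicol2026's weighted-L²
method is max-principle-free and "flexible"). #3 QuarterTurnLiouville (typed, ¬-side: ∀ c R
quarter-turn, RotatedTypeIDSSLiouville c R unfolded; why it might fail: #2; no Bernoulli-type
max-principle quantity exists for twisted profiles (BradshawTsai2017CPDE OP 5.2 remark,
PineauVicol2026 p.4) and PV's levers — ∂_sU small (λ≈1) or RU small (|α| ≫ 1) — are absent at
moderate λ with a discrete twist). #4 CirculationLedgerFunnel (INFORMAL until
`rdssSectionalCirculation` is defined; mechanism for #3; why it might fail: pitfalls found while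
typing — flux through a full meridional half-plane is log-divergent for Type-I far fields (|curl U|
~ |y|⁻²), sup-circulation over loops is +∞ by multi-winding around linked vortex lines, and bounded
sections leak O(1) circulation per unit s through the outward drift y/2 (= debris of parent
generations, cf. NoSilentTypeIProfile); re-bundling/merger can raise per-structure circulation at
energetic cost ~ NΓ²ℓ; three route reviews (40af5994, 65db103a, 869a0ed8) concur the quantity is
ill-defined as sketched — it stays informal until a definition lands or it is demoted).
SUPPORT (rank 9). NearIdentityRemoval (∀C₀ ∃c₁>1: quarter-turn RDSS Type-I(C₀) ancient mild with
1<c<c₁ ⇒ 0; = KNSS regularity + R⁴=1 ⇒ c⁴-DSS + ChaeWolf2017RemovingDSS Thm 1.3, PROVED in tree as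
Literature.Analysis.FluidPDE.chaeWolf2017_removing_dss_holds (classical form; the remaining gap is
Type-I ancient mild ⇒ classical, KNSS2009 §4)); QuarterTurnRdssIsDss4 (bookkeeping: quarter-turn
(c,R)-RDSS ⇒ c⁴-DSS; sorry-free candidate proof attached by refuter 869a0ed8 — a prover only has to
land it; it is a hypothesis of `closes`); NoSilentTypeIProfile (a Type-I ancient mild solution whose
final datum vanishes outside a ball is trivial: EscauriazaSereginSverak2003 backward uniqueness in
the exterior region where |u|+|∇u| is bounded by the Type-I bound, then unique continuation — the
rigorous "every generation leaves debris", shared interest with TypeILiouville);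
DssProfileTruncation (stmt-2459: plain-DSS, conjecture-free truncation bridge, hypothesis =
¬TypeIDSSLiouville c unfolded, conclusion = X5a; a proved corollary of the shared wall-form bridge
stmt-0901, same similarity-variable truncation; hypothesis of `closes`) and ClayUniqueness (=
stmt-0153 verbatim, shared with Blowup and 15 other routes; hypothesis of `closes`). Route repair
2026-08-15 (planner g2): DssTruncationBridge (stmt-0901) and the inlined Assembly item (stmt-1105)
dropped from THIS route (0901 keeps its other routes); imports narrowed to ClassicalSolution /
LerayHopf / SelfSimilar / NSWave0 (SelfSimilarLiouville and SuitableWeak were only needed by the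
dropped items); deciding theorem `closes` supplied.
KILL CRITERIA. #3 proved — or TypeIDSSLiouvilleConjecture, or
Literature.Analysis.FluidPDE.LiouvilleConjectureNS (stmt-0057) — refutes #2: close
`refuted:QuarterTurnProfileExists` (ledger lemma and NoSilentTypeIProfile survive as support for
TypeILiouville). DssProfileTruncation refuted (a fortiori stmt-0901 refuted) ⇒ `closes` unreachable:
re-hang #2 on DssFarFieldSlaving's conditional HyperbolicDssBridge or close `exhausted`. X5b refuted
(stmt-0154 proved) ⇒ as for Blowup. NoBlowup (stmt-0054) proved ⇒ moot. A Leray-variables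
computation of the twisted period map P_R = R⁻¹∘Φ_{2 log λ} near the pair→sheet→pair cycle with no
fixed point at any λ is not a refutation but demotes #2 below #3.
NOT DECOMPOSED YET. How #2 is built (seeding by the McKeown/BHP geometry, harmonic-balance or
Newton–Kantorovich search for a fixed point of P_R, gluing); the ledger's definitions (half-annulus
sectional circulation, "generation structure") — filed as a definition request only when a grounder
asks; truncation (route DssFarFieldSlaving) and X5b (route Blowup) are attacked there, not here.
Candidate later split of #3 (≤ 2 children + glue): NoTwistedTypeIOrbit (every quarter-turn RDSS
Type-I ancient solution is a.e. R-equivariant — the exact negation of #2) + TypeIDSSLiouville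
restricted to 4-fold-symmetric profiles.
CHEAPEST FALSIFIER. Theory side: any removal theorem for c⁴-DSS Type-I profiles WITHOUT the
near-identity restriction λ < λ_*(C₀) (an all-λ version of ChaeWolf2017RemovingDSS Thm 1.3 /
PineauVicol2026 Thm 1.6, or PineauVicol2026 Thm 1.7 extended to the resonant phase 2α log λ = π/2)
proves QuarterTurnLiouville outright and closes #2 `refuted` — the first lookup a refuter should run
(lit frontier on arXiv:2607.09619 / arXiv:1610.09464 citers). Computation side: discretise the
twisted return map P_R = R⁻¹∘Φ_{2 log λ} of the similarity-variable semiflow seeded by the BHP2016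
iteration map and scan λ ∈ (λ_*(C₀)^{1/4}, 10]; no near-fixed point at any λ demotes #2 below #3.
NUMBERS. R⁴ = 1, phase π/2, α = π/(2S), S = 2 log λ; quarter-turn RDSS ⊂ λ⁴-DSS; known removals: λ⁴
< λ_*(C₀) (ChaeWolf2017RemovingDSS Thm 1.3), PV2026 Thm 1.7 clauses both void for α = π/(4 log λ), λ
→ 1⁺; observed circulation transfer per generation x_Γ ≈ 0.25 (MckeownEtAl2020 p.4), BHP2016 ledger
Γ_{n+1} = C(b_n/a_n)Γ_n (eq. 19); KNSS Liouville cases in tree: 2 (Thms 5.2, 5.3). Items after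
repair: 8 (3 cruxes: 2 typed + 1 informal; 5 support incl. 1 shared); deciding theorem over 4 of
them (1 crux + 3 support).

Novelty: NOVELTY (searched 2026-08-15, this session: `lit search --source zbmath "rotated discretely
self-similar Navier-Stokes"` → 1 hit, PineauVicol2026 = arXiv:2607.09619, READ pp.1,3–8 (Conj. 1.1 =
Perelman/Tsai 8.9, Thms 1.4, 1.6, 1.7, Rmk 1.8, §1.5); `lit read arXiv:1610.05680` pp.3–5,14
(BradshawTsai2017CPDE: RDSS definition, nφ = 2πm ⇒ λⁿ-DSS, Perelman attribution, Open Problems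
5.1–5.3); `lit read arXiv:1610.09464` p.3 (ChaeWolf2017RemovingDSS Thms 1.1, 1.3, Rmk 1.4); `lit
galaxy search "rotated discretely self-similar" --star all` → 0 hits in panama/pdf/crabby; `lit
frontier NavierStokesRegularity --since 2021` (30 rows: forward/2-D/hypodissipative self-similar
only, e.g. arXiv:2601.03161, arXiv:2603.12497, arXiv:2601.03833); `lit bridges --cross any` (surveys
only); searchd hybrid and arXiv API were rc 75 / HTTP 429 during the session (noted, not worked
around); plus the card's refuter audit (refuter-novelty-audit-7, 2026-08-15: BHP2016
doi:10.1103/physrevfluids.1.084503 pp.8–12, MckeownEtAl2020 arXiv:1908.01804 p.4/p.6) and the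
in-tree docstrings of Literature.Analysis.FluidPDE.RotatedTypeIDSSLiouville /
TypeIDSSLiouvilleConjecture / chae_wolf_dss_existence.
Nearest prior art. (1) PineauVicol2026 (arXiv:2607.09619): Type-I Liouville for backward RSS with
|α| ≪ 1 or |α| ≫ 1 (Thm 1.4) and for (α,λ)-RDSS with λ near 1 and extreme α (Thm 1.7), by a
weighted-L² (adjoint-kernel weight) method that needs no maximum principle; Rmk 1.8 (Šverák):
DSS/RDSS are NS "breathers". (2) Bra  [refs: 10.1103/physrevfluids.1.084503, 2607.09619, 1610.05680, 1610.09464, 2601.03161, 2603.12497, 2601.03833, 1908.01804, doi:10.1103/physrevfluids.1.084503, PineauVicol2026, MckeownEtAl2020, Tsai2018, BrennerHormozPumir2016]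

Barriers (technique_class: blowup-construction rotated-dss circulation-ledger): BARRIERS (catalogue Literature/Barriers/NavierStokesRegularity read: AxisymmetricTypeIExclusion,
LeraySelfSimilarBlowupExclusion, CriticalNormBlowupNecessity, SingularSetDimensionBound,
DyadicCascadeRegularity/TruncatedDyadicBlowup, TaoAveragedBlowup, EnergySupercriticality; negatives
index: 0 refuted statements on 2026-08-15).
- Literature.Barriers.NavierStokesRegularity.LeraySelfSimilarBlowupExclusion (necas_ruzicka_sverak ∧
tsai_selfsimilar ∧ tsai_selfsimilar_local_energy): applies to EXACTLY backward self-similar profiles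
(λ-continuous). Evaded by discreteness as the entry's evasions_known records: crux #2 asks for a
genuinely s-periodic twisted orbit (λ-DSS only with factor λ⁴, λ⁴ outside the Chae–Wolf window); the
window itself (ChaeWolf2017RemovingDSS Thm 1.3, PineauVicol2026 Thms 1.6–1.7) is filed honestly as
support NearIdentityRemoval and constrains #2 to λ⁴ ≥ λ_*(C₀).
- Literature.Barriers.NavierStokesRegularity.AxisymmetricTypeIExclusion (SereginSverak2009; in-tree
knss_no_axisymmetric_typeI, knss_bound_C_over_r): applies to any axisymmetric Type-I profile. Crux
#2 evades it by design — the quarter-turn acts nontrivially (twist clause), so the profile is not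
axisymmetric (axisymmetric ⇒ R-equivariant ⇒ plain DSS, BradshawTsai2017CPDE p.4); on the ¬-side the
barrier is the intended ENDPOINT of the ledger (#4: funnel ⇒ axisymmetric-like ⇒ excluded), exactly
as PineauVicol2026 p.5 uses the axisymmetric kernel of J − (Jy)·∇ for |α| ≫ 1.
- Literature.Barriers.NavierSto

Novelty grade: variant — ROUTE REVIEW (refuter 40af5994, 2026-08-15). VERDICT: well-typed two-sided negative route; keep open, with three notes. ELAB: all 8 typed bodies rc0 verbatim under the route's imports (probe V_ns.lean, clean; module farm-unbuilt rc75); PROVED: 1100 → ¬1101 and 1100 → ¬TypeIDSSLiouvilleConjecture (ev (refuter refuter-rreview-route-HubbardSuperconduc-40af5994-0, 2026-08-15T11:17:53Z; prior: arXiv:2607.09619 (PineauVicol2026 Thm 1.7, Rmk 1.8: (α,λ)-RDSS Liouville near identity; p.7 READ), arXiv:1610.05680 (BradshawTsai2017CPDE §1 RDSS, §5 OP 5.1), Tsai2018 Conj. 8.8–8.9, arXiv:1610.09464 (ChaeWolf2017 Thm 1.3), arXiv:1908.01804 (MckeownEtAl2020: iterative reconnection cascade, x_Γ≈0.25), doi:10.1103/physrevfluids.1.084503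 (BrennerHormozPumir2016 iteration map))

History (route lifecycle, newest last):
- 2026-08-15T16:16:25Z · rev 3: restated Assembly (stmt-NavierStokesRegularity-1105) — route-repair (glue; planner g2, 2026-08-15): deciding theorem supplied with --refutation — closes : QuarterTurnProfileExists → QuarterTurnRdssIsDss4 → DssProfil (planner-rbadge-NavierStokesRegularity-QuarterT-801b62bc-g2-0)
- 2026-08-15T16:16:25Z · rev 3: dropped DssTruncationBridge — route-repair (glue; planner g2, 2026-08-15): deciding theorem supplied with --refutation — closes : QuarterTurnProfileExists → QuarterTurnRdssIsDss4 → DssProfil (planner-rbadge-NavierStokesRegularity-QuarterT-801b62bc-g2-0)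
- 2026-08-23T17:06:10Z · DORMANT — reconciler: no traction for 6.1 d (last activity item-evidence-added at 2026-08-17T13:20:41Z); parked, not closed — `ledger route dormant route-NavierStokesRegu (operator:999:3683993)
- 2026-08-27T03:04:56Z · REACTIVATED — reconciler: reactivated — activity item-proof-filed at 2026-08-27T01:51:49Z after parking at 2026-08-23T17:06:10Z (operator:999:2430320)

sub-problem: NavierStokesRegularity · status: open · opened planner-plancard-NavierStokesRegularity-Navie-c6e328a1-0 2026-08-15T10:50:55Z · rev 3 · ledger route-NavierStokesRegularity-QuarterTurnRdss
GENERATED by the gate from the ledger (D-0016/17). Provers cite these decls: `theorem foo : Summit.NavierStokesRegularity.NavierStokesRegularity.Theses.QuarterTurnRdss.<Decl> := …` in Summits/NavierStokesRegularity/NavierStokesRegularity/Theorems/<Name>.lean.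
-/

namespace Summit.NavierStokesRegularity.NavierStokesRegularity.Theses.QuarterTurnRdss

open scoped BigOperators Topology Manifold Classical MeasureTheory ProbabilityTheory Matrix InnerProductSpace ComplexConjugate ContinuousMap
open Filter Set Function TopologicalSpace MeasureTheory

attribute [summit_statement] _root_.NavierStokesRegularity

open Literature.NS

/-- item stmt-NavierStokesRegularity-1100 · crux · rank 2 · open · by planner
why it might fail: Perelman–Tsai Conj. 8.9 (= BT2017 OP 5.1) predicts NO Type-I backward RDSS profile; every settled case is trivial (NRŠ/Tsai SS; ChaeWolf2017 Thm 1.3 ⇒ here c⁴ ≥ λ_*(C₀); PV2026 Thms 1.4/1.7; KNSS axisymmetric); AB2019: such a profile = a Type-I singularity; real cascades split circulation, x_Γ≈0.25.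
sources: Tsai2018, BradshawTsai2017CPDE, PineauVicol2026, ChaeWolf2017RemovingDSS, AlbrittonBarker2019, KochNadirashviliSereginSverak2009
[crux] (rank 2; the construction, NEGATIVE side; card quarter-turn-rdss-funnel RDSS-EXIST) There are
λ>1 and a NONTRIVIAL ancient mild solution u (ν=1) on ℝ³×(−∞,0), measurable slices, Type-I bound |u|
≤ C₀/(|x|+√−t), which is rotated-DSS with factor λ and the quarter-turn R about the x₃-axis
(λRᵀu(λ²t,λRx) = u(t,x); R pinned by (Rx)₀=−x₁,(Rx)₁=x₀,(Rx)₂=x₂, so R⁴=1 and u is λ⁴-DSS) and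
GENUINELY TWISTED: its slices are not all a.e. R-equivariant (⇔ u is not λ-DSS). In Leray variables:
a Type-I breather U(·,s+2logλ) = RᵀU(R·,s) — the symmetry class of the observed perpendicular
cascade pair→sheet→perpendicular pair (MckeownEtAl2020, BrennerHormozPumir2016 Sec. VI), =
(α,λ)-RDSS with resonant phase 2α log λ = π/2 (BradshawTsai2017CPDE §1, PineauVicol2026 §1.4). A
counterexample to RotatedTypeIDSSLiouville λ R, hence to the wall TypeIDSSLiouvilleConjecture
(Blowup #5, DssFarFieldSlaving H1) in a prescribed non-axisymmetric sector. Constraints already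
known: λ⁴ ≥ λ_*(C₀) (NearIdentityRemoval), the circulation ledger (crux CirculationLedgerFunnel)
says the profile must be a FUNNEL (per-generation circulation transfer x_Γ = 1, unlike the measured
x_Γ≈0.25). Construction ideas (not decomp -/
@[route_item "route-NavierStokesRegularity-QuarterTurnRdss", crux]
def QuarterTurnProfileExists : Prop :=
  ∃ c : ℝ, 1 < c ∧ ∃ R : EuclideanSpace ℝ (Fin 3) ≃ₗᵢ[ℝ] EuclideanSpace ℝ (Fin 3), (∀ x : EuclideanSpace ℝ (Fin 3), (R x) 0 = -(x 1) ∧ (R x) 1 = x 0 ∧ (R x) 2 = x 2) ∧ ∃ u : ℝ → EuclideanSpace ℝ (Fin 3) → EuclideanSpace ℝ (Fin 3), Literature.Analysis.FluidPDE.IsAncientMildSolution 1 u ∧ (∀ t < 0, AEStronglyMeasurable (u t) volume) ∧ Literature.Analysis.FluidPDE.IsRotatedDSS c R u ∧ (∃ C₀ : ℝ, Literature.Analysis.FluidPDE.HasTypeIDecay C₀ u) ∧ ¬ (∀ t < 0, u t =ᵐ[volume] 0) ∧ ¬ (∀ t < 0, (fun x => u t (R x)) =ᵐ[volume] fun x =>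 R (u t x))

/-- item stmt-NavierStokesRegularity-1101 · crux · rank 3 · open · by planner
why it might fail: Its negation QuarterTurnProfileExists may hold; PV2026 Thm 1.7 is void here (2α log c ≡ π/2 mod 2π forces |α| ≥ π/(4 log c), so (1+α²)log c → ∞ as c→1⁺; else c<λ̲ fails); only the window c⁴<λ_*(C₀) is settled (ChaeWolf2017 Thm 1.3); no max-principle quantity for twisted profiles (BT2017 OP 5.2).
sources: PineauVicol2026, ChaeWolf2017RemovingDSS, BradshawTsai2017CPDE, Tsai2018, KochNadirashviliSereginSverak2009, SereginSverak2009
[crux] (rank 3; ¬-side of the route, card (D+) RDSS-Liouville) Type-I RDSS Liouville in the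
quarter-turn class: for every λ (vacuous unless λ>1) and the quarter-turn R about the x₃-axis, every
ancient mild solution (ν=1, measurable slices) that is (λ,R)-RDSS with a Type-I bound vanishes a.e.
on every slice t<0 — Literature.Analysis.FluidPDE.RotatedTypeIDSSLiouville λ R. Special case of the
wall TypeIDSSLiouvilleConjecture (Tsai2018 Conj. 8.8–8.9 = BradshawTsai2017CPDE Open Problem 5.1)
isolating the resonant phase φ=π/2; refutes QuarterTurnProfileExists (glue in Sketch.lean). Known:
only the λ⁴-DSS embedding near λ=1 (NearIdentityRemoval: ChaeWolf2017RemovingDSS Thm 1.3 /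
PineauVicol2026 Thm 1.6 with factor λ⁴); PineauVicol2026 Thm 1.7 ((α,λ)-RDSS removed for |α|≤α̲,λ<λ̲
or |α|≥ᾱ,λ<λ̲^{1/(1+α²)}) is VOID here since α = π/(4 log λ) gives (1+α²)log λ ≥ π²/(16 log λ) → ∞
as λ→1⁺. Proposed mechanism: the circulation ledger (crux CirculationLedgerFunnel) ⇒ funnel ⇒
axisymmetric-like ⇒ excluded by SereginSverak2009 / knss_bound_C_over_r, mirroring PineauVicol2026
p.5 (large twist pushes U toward ker(J−(Jy)·∇) = axisymmetric fields). Alternative: extend PV's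
adjoint-kernel weighted enstro -/
@[route_item "route-NavierStokesRegularity-QuarterTurnRdss"]
def QuarterTurnLiouville : Prop :=
  ∀ (c : ℝ) (R : EuclideanSpace ℝ (Fin 3) ≃ₗᵢ[ℝ] EuclideanSpace ℝ (Fin 3)), (∀ x : EuclideanSpace ℝ (Fin 3), (R x) 0 = -(x 1) ∧ (R x) 1 = x 0 ∧ (R x) 2 = x 2) → 1 < c → ∀ u : ℝ → EuclideanSpace ℝ (Fin 3) → EuclideanSpace ℝ (Fin 3), Literature.Analysis.FluidPDE.IsAncientMildSolution 1 u → (∀ t < 0, AEStronglyMeasurable (u t) volume) → Literature.Analysis.FluidPDE.IsRotatedDSS c R u → (∃ C₀ : ℝ, Literature.Analysis.FluidPDE.HasTypeIDecay C₀ u) → ∀ t < 0, u t =ᵐ[volume] 0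

-- item stmt-NavierStokesRegularity-1120 · crux · rank 4 · open · by planner — informal only, no Lean statement yet:
--   [crux] (rank 4; INFORMAL until a notion `rdssSectionalCirculation` is defined — the card's
--   CIRCULATION LEDGER, mechanism for QuarterTurnLiouville) Setting: u as in QuarterTurnLiouville's
--   hypotheses (smooth for t<0 by KNSS2009 §4), Leray variables U(y,s) = √(−t)u(√(−t)y,t), s = −log(−t),
--   so ∂_sU = (U+y/2)×Ω − curl Ω − ∇(P+|U|²/2+y·U/2), Ω = curl U, U(·,s+S) = RᵀU(R·,s), S = 2 log λ, and
--   circulation is scale-free: ∮_γ U(s)·dl = ∮_{√(−t)γ} u(t)·dx; along loops moved by U+y/2 it changes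
--   only by −∮ curl Ω·dl (Kelvin: viscosity taxes circulation, nothing mints it). LEDGER, rigorous half:
--   for the fin

/-- item stmt-NavierStokesRegularity-0153 · support · rank 9 · closed · proved by Summit.NavierStokesRegularity.NavierStokesRegularity.Theorems.adiabaticEddy_clayUniqueness_proof @ bd26efe366a2 (prover) · by planner
sources: Fefferman2000, Tao2011
Fefferman's class (A) = jointly C^∞ on ℝ³×[0,∞) + sup_t ∫|u|² < ∞; no energy inequality, no decay of
∇u, no integrability in LPS scales is assumed. Claim: such (u,p) coincides on [0,T) with any
Leray–Hopf classical solution v from the same rapidly decaying datum. Expected route: smoothness +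
bounded energy ⇒ u is a distributional solution with locally finite dissipation?? (NOT automatic:
∫∫|∇u|² may be infinite) — this is exactly the delicate point; alternatives: Liouville-type control
of the pressure (p harmonic part must be affine ⇒ excluded by bounded energy), then local energy
inequality, then weak–strong uniqueness (Prodi 1959, Serrin 1963) against v which is in every LPS
class on compacts of [0,T). [sources: Prodi1959, Serrin1963, Fefferman2000, LemarieRieusset2002,
RobinsonRodrigoSadowski2016] -/
@[route_item "route-NavierStokesRegularity-QuarterTurnRdss", crux]
def ClayUniqueness : Prop :=
  ∀ ν : ℝ, 0 < ν → ∀ (u₀ : EuclideanSpace ℝ (Fin 3) → EuclideanSpace ℝ (Fin 3)), Literature.Analysis.FluidPDE.HasRapidSpatialDecay u₀ → ∀ (u v : ℝ → EuclideanSpace ℝ (Fin 3) → EuclideanSpace ℝ (Fin 3)) (p q : ℝ → EuclideanSpace ℝ (Fin 3) → ℝ) (T : ℝ), 0 < T → Literature.Analysis.FluidPDE.IsSmoothOnHalfSpace u → Literature.Analysis.FluidPDE.IsSmoothOnHalfSpace p → Literature.Analysis.FluidPDE.IsNavierStokesSolution ν 0 u₀ u p → Literature.Analysis.FluidPDE.HasBoundedEnergy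 u → Literature.Analysis.FluidPDE.IsClassicalNSSolutionOn (Set.Ico 0 T) ν 0 v q → Literature.Analysis.FluidPDE.IsLerayHopfOn T ν 0 u₀ v → v 0 = u₀ → ∀ t ∈ Set.Ico 0 T, u t = v t

/-- `ClayUniqueness` holds: proved by `Summit.NavierStokesRegularity.NavierStokesRegularity.Theorems.adiabaticEddy_clayUniqueness_proof` @ bd26efe366a2. -/
theorem ClayUniqueness_holds : ClayUniqueness := _root_.Summit.NavierStokesRegularity.NavierStokesRegularity.Theorems.adiabaticEddy_clayUniqueness_proof

/-- item stmt-NavierStokesRegularity-1102 · support · rank 9 · closed · proved by Summit.NavierStokesRegularity.NavierStokesRegularity.Theorems.CorkscrewProfile.Birth.quarterTurn_nearIdentityRemoval (prover) · by planner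
sources: ChaeWolf2017RemovingDSS, PineauVicol2026, KochNadirashviliSereginSverak2009, BradshawTsai2017CPDE
[support] Near-identity removal in the quarter-turn class: for every Type-I constant C₀ there is
c₁>1 such that every ancient mild (ν=1, measurable slices) (c,R)-RDSS solution with R the
quarter-turn, 1<c<c₁ and |u| ≤ C₀/(|x|+√−t) vanishes a.e. on every slice t<0. Expected proof
(~routine given the facts): Type-I ⇒ bounded on each (−∞,−δ) ⇒ smooth representative (KNSS2009 §4
regularity of bounded mild ancient solutions, in-tree KNSS facts); QuarterTurnRdssIsDss4 ⇒ u is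
c⁴-DSS; ChaeWolf2017RemovingDSS Thm 1.3 (arXiv:1610.09464 p.3: ∀C_* ∃λ_*(C_*)>1, smooth λ-DSS on
ℝ³×(−∞,0) with |u| ≤ C_*/(√−t+|x|) and λ∈(1,λ_*) ⇒ u≡0; quantitative reproof PineauVicol2026 Thm
1.6) with λ = c⁴, i.e. c₁ := λ_*(C₀)^{1/4}. The Chae–Wolf theorem is NOT yet a named Literature fact
(cite item filed); a prover may vendor it as `def … : Prop` and prove this item in hypothesis form
first. Records honestly the part of QuarterTurnLiouville that is known and constrains
QuarterTurnProfileExists to c⁴ ≥ λ_*(C₀). Note PineauVicol2026 Thm 1.7 does NOT give more here: the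
quarter-turn phase forces α = π/(4 log c) → ∞ with (1+α²)log c → ∞ as c→1⁺. -/
@[route_item "route-NavierStokesRegularity-QuarterTurnRdss"]
def NearIdentityRemoval : Prop :=
  ∀ C₀ : ℝ, ∃ c₁ : ℝ, 1 < c₁ ∧ ∀ c : ℝ, 1 < c → c < c₁ → ∀ R : EuclideanSpace ℝ (Fin 3) ≃ₗᵢ[ℝ] EuclideanSpace ℝ (Fin 3), (∀ x : EuclideanSpace ℝ (Fin 3), (R x) 0 = -(x 1) ∧ (R x) 1 = x 0 ∧ (R x) 2 = x 2) → ∀ u : ℝ → EuclideanSpace ℝ (Fin 3) → EuclideanSpace ℝ (Fin 3), Literature.Analysis.FluidPDE.IsAncientMildSolution 1 u → (∀ t < 0, AEStronglyMeasurable (u t) volume) → Literature.Analysis.FluidPDE.IsRotatedDSS c R u → Literature.Analysis.FluidPDE.HasTypeIDecay C₀ u → ∀ t < 0, u t =ᵐ[volume] 0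

-- `NearIdentityRemoval` holds: proved by `Summit.NavierStokesRegularity.NavierStokesRegularity.Theorems.CorkscrewProfile.Birth.quarterTurn_nearIdentityRemoval` (its module imports this route file, so no `_holds` link can be stated here).

/-- item stmt-NavierStokesRegularity-1103 · support · rank 9 · closed · proved by Summit.NavierStokesRegularity.NavierStokesRegularity.Theorems.quarterTurnRdss_quarterTurnRdssIsDss4_proof (prover) · by planner
sources: BradshawTsai2017CPDE
[support] Bookkeeping (BradshawTsai2017CPDE §1, arXiv:1610.05680 p.3: 'if nφ = 2πm then v is DSS
with factor λⁿ'): a (c,R)-rotated-DSS field with R the quarter-turn about the x₃-axis (coordinates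
(Rx)₀=−x₁,(Rx)₁=x₀,(Rx)₂=x₂, hence R∘R∘R∘R = id) is c⁴-discretely self-similar: iterate
c•R⁻¹u(c²t,cRx) = u(t,x) four times, pulling scalars through the linear isometry. ~30 lines; used by
NearIdentityRemoval and by the glue 'quarter-turn profile ⇒ ¬TypeIDSSLiouville (c⁴)'. -/
@[route_item "route-NavierStokesRegularity-QuarterTurnRdss", crux]
def QuarterTurnRdssIsDss4 : Prop :=
  ∀ (c : ℝ) (R : EuclideanSpace ℝ (Fin 3) ≃ₗᵢ[ℝ] EuclideanSpace ℝ (Fin 3)) (u : ℝ → EuclideanSpace ℝ (Fin 3) → EuclideanSpace ℝ (Fin 3)), 0 < c → (∀ x : EuclideanSpace ℝ (Fin 3), (R x) 0 = -(x 1) ∧ (R x) 1 = x 0 ∧ (R x) 2 = x 2) → Literature.Analysis.FluidPDE.IsRotatedDSS c R u → Literature.Analysis.FluidPDE.IsDiscretelySelfSimilar (c ^ 4) u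

-- `QuarterTurnRdssIsDss4` holds: proved by `Summit.NavierStokesRegularity.NavierStokesRegularity.Theorems.quarterTurnRdss_quarterTurnRdssIsDss4_proof` (its module imports this route file, so no `_holds` link can be stated here).

/-- item stmt-NavierStokesRegularity-1104 · support · rank 9 · closed · proved by Summit.NavierStokesRegularity.NavierStokesRegularity.Theorems.NoSilentTypeIProfile.quarterTurnRdss_noSilentTypeIProfile_proof (prover) · by planner
sources: EscauriazaSereginSverak2003, KochNadirashviliSereginSverak2009, AlbrittonBarker2019
[support] 'Every Type-I ancient solution leaves debris' (the rigorous brick under the circulation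
ledger; of independent use to route TypeILiouville): an ancient mild solution (ν=1, measurable
slices) with a Type-I bound |u| ≤ C₀/(|x|+√−t) whose final datum vanishes outside some ball —
rendered robustly as ∫_{ρ<|x|<r} |u(t,x)| dx → 0 as t→0⁻ for every r>ρ — is trivial (a.e. zero
slices). Expected proof: in the exterior region {|x|>ρ}×(−1,0) the Type-I bound gives |u| ≤ C₀/ρ and
(local regularity, KNSS2009 §2–4 / Serrin) |∇u|,|∇²u| bounded, so ω = curl u solves |∂_tω − Δω| ≤
M(|ω|+|∇ω|) there with ω(·,0)=0 on {|x|>ρ'}; EscauriazaSereginSverak2003 backward uniqueness in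
ℝ³∖B_ρ' (in-tree BackwardUniquenessCore* files) ⇒ ω ≡ 0 on the exterior region × (−1,0); spatial
unique continuation (ESS2003 / analyticity) ⇒ ω ≡ 0 on ℝ³×(−1,0); then u(t) is harmonic with Type-I
decay ⇒ u ≡ 0 for t∈(−1,0), and for all t<0 by the ancient scaling/time-translation or by repeating
on (−T,0). Contrapositive used by the route: the final datum u₀ of a nontrivial Type-I (R)DSS
profile is nonzero in EVERY dyadic shell (homogeneity), i.e. each generation's debris is really
there. Why recorded: it is the only -/
@[route_item "route-NavierStokesRegularity-QuarterTurnRdss"]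
def NoSilentTypeIProfile : Prop :=
  ∀ u : ℝ → EuclideanSpace ℝ (Fin 3) → EuclideanSpace ℝ (Fin 3), Literature.Analysis.FluidPDE.IsAncientMildSolution 1 u → (∀ t < 0, AEStronglyMeasurable (u t) volume) → (∃ C₀ : ℝ, Literature.Analysis.FluidPDE.HasTypeIDecay C₀ u) → (∃ ρ : ℝ, ∀ r : ℝ, ρ < r → Tendsto (fun t => ∫⁻ x in {x : EuclideanSpace ℝ (Fin 3) | ρ < ‖x‖ ∧ ‖x‖ < r}, ‖u t x‖ₑ ∂volume) (𝓝[<] 0) (𝓝 0)) → ∀ t < 0, u t =ᵐ[volume] 0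

-- `NoSilentTypeIProfile` holds: proved by `Summit.NavierStokesRegularity.NavierStokesRegularity.Theorems.NoSilentTypeIProfile.quarterTurnRdss_noSilentTypeIProfile_proof` (its module imports this route file, so no `_holds` link can be stated here).

/-- item stmt-NavierStokesRegularity-2459 · support · rank 9 · closed · proved by Summit.NavierStokesRegularity.NavierStokesRegularity.Theorems.dssProfileTruncation_proof (prover) · by planner
[support] (rank 9; route-repair replacement in THIS route for the shared DssTruncationBridge
stmt-0901) plain-DSS, conjecture-free truncation bridge: if some λ>1 admits a NONTRIVIAL ancient
mild solution (ν=1, measurable slices) on ℝ³×(−∞,0), λ-DSS, Type-I bounded |u| ≤ C₀/(|x|+√−t), then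
some rapidly decaying datum has a Leray–Hopf classical solution of FINITE maximal lifespan (X5a of
blowup_assembly). Hypothesis = ¬TypeIDSSLiouville λ UNFOLDED (the R=1 conjunct of the wall), so
stmt-0901 (¬TypeIDSSLiouvilleConjecture → same conclusion; route DssFarFieldSlaving et al.) implies
it in 4 lines (SketchProofs.lean rc 0): prove it as that corollary or directly by the same
similarity-variable truncation (transport 𝓛-bounded from |y||U| ≤ C₀; Bogovskiĭ-corrected cut-off
datum, error O(e^{−R²/8}) in L²(γ)). Uses only FluidPDE.SelfSimilar/ClassicalSolution/LerayHopf
vocabulary (nothing from SelfSimilarLiouville.lean); this route's profile is c⁴-DSS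
(QuarterTurnRdssIsDss4), so the plain-DSS bridge is all its Assembly needs. Why it might fail: the
truncated solution may regularise instead of shadowing the DSS orbit up to t=T. [sources:
JiaSverak2014, BradshawTsai2017CPDE, Tsai2018] -/
@[route_item "route-NavierStokesRegularity-QuarterTurnRdss", crux]
def DssProfileTruncation : Prop :=
  (∃ c : ℝ, 1 < c ∧ ∃ u : ℝ → EuclideanSpace ℝ (Fin 3) → EuclideanSpace ℝ (Fin 3), Literature.Analysis.FluidPDE.IsAncientMildSolution 1 u ∧ (∀ t < 0, AEStronglyMeasurable (u t) volume) ∧ Literature.Analysis.FluidPDE.IsDiscretelySelfSimilar c u ∧ (∃ C₀ : ℝ, Literature.Analysis.FluidPDE.HasTypeIDecay C₀ u) ∧ ¬ (∀ t < 0, u t =ᵐ[volume] 0)) → ∃ ν : ℝ, 0 < ν ∧ ∃ T : ℝ, 0 < T ∧ ∃ (u : ℝ → EuclideanSpace ℝ (Fin 3) → EuclideanSpace ℝ (Fin 3)) (p : ℝ → EuclideanSpace ℝ (Fin 3) → ℝ), Literature.Analysis.FluidPDE.IsMaximalSmoothSolution ν 0 u p T ∧ Literature.Analysis.FluidPDE.IsLerayHopfOn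 T ν 0 (u 0) u ∧ Literature.Analysis.FluidPDE.HasRapidSpatialDecay (u 0)

-- `DssProfileTruncation` holds: proved by `Summit.NavierStokesRegularity.NavierStokesRegularity.Theorems.dssProfileTruncation_proof` (its module imports this route file, so no `_holds` link can be stated here).

-- earlier Assembly (stmt-NavierStokesRegularity-1105, replaced 2026-08-15T16:16:25Z -> stmt-NavierStokesRegularity-10467): retired by None — (∃ c : ℝ, 1 < c ∧ ∃ R : EuclideanSpace ℝ (Fin 3) ≃ₗᵢ[ℝ] EuclideanSpace ℝ (Fin 3), (∀ x : EuclideanSpace ℝ (Fin 3), (R x) 0 = -(x 1) ∧ (R x) 1 = x 0 ∧ (R x) 2 = x 2) ∧ ∃ u : ℝ → EuclideanSpace ℝ (Fin 3) → EuclideanSpace ℝ (Fin 3), Literature.Analysis.FluidPDE.Is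
/-- item stmt-NavierStokesRegularity-10467 · assembly · rank 1 · closed · proved by Summit.NavierStokesRegularity.NavierStokesRegularity.Theorems.quarterTurnRdss_assembly_proof (prover) · by planner
sources: Fefferman2000
[assembly] QuarterTurnProfileExists → QuarterTurnRdssIsDss4 → DssProfileTruncation → ClayUniqueness
→ ¬NavierStokesRegularity, over the route's OWN decl names — literally the type of the deciding
theorem `closes` (D-0027 §2.1) rendered at the end of this file, so a prover lands it in one line
(`theorem assembly_holds : Assembly := closes`, or `fun hX h4 hT hU => closes hX h4 hT hU`) in
Theorems/QuarterTurnRdssAssembly.lean. Content: the quarter-turn profile is c⁴-DSS (R⁴ = 1), the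
conjecture-free truncation bridge gives a rapidly decaying datum with a finite-lifespan Leray–Hopf
classical solution (X5a), Clay (A) + ClayUniqueness (X5b) extend it past its lifespan — the argument
of Literature.NS.blowup_assembly. Supersedes the rev-2 inlined Assembly (profile → wall-form bridge
stmt-0901 → stmt-0153 → ¬NS), retired by this route repair because it carried
TypeIDSSLiouvilleConjecture into the cone. [sources: Fefferman2000, BealeKatoMajda1984] -/
@[route_item "route-NavierStokesRegularity-QuarterTurnRdss"]
def Assembly : Prop :=
  QuarterTurnProfileExists → QuarterTurnRdssIsDss4 → DssProfileTruncation → ClayUniqueness → ¬ NavierStokesRegularity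

-- `Assembly` holds: proved by `Summit.NavierStokesRegularity.NavierStokesRegularity.Theorems.quarterTurnRdss_assembly_proof` (its module imports this route file, so no `_holds` link can be stated here).

/-! D-0027 §2.1 — DECIDING THEOREM (planner-authored via `route open/edit --closes-file`; by planner-rbadge-NavierStokesRegularity-QuarterT-801b62bc-g2-0 2026-08-15T16:16:25Z):
its hypotheses are this route's items and its conclusion the sub-problem Statement (glue_lint), and it elaborates with this file. -/

/-- DECIDING THEOREM (D-0027 §2.1), NEGATIVE side: the route refutes Clay (A). From the quarter-turn
profile `(c, R, u)` of `QuarterTurnProfileExists` (nontrivial ancient mild, Type-I, `(c,R)`-RDSS with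
`R⁴ = 1`), `QuarterTurnRdssIsDss4` makes `u` a plain `c⁴`-DSS profile (`1 < c⁴`); the conjecture-free
truncation bridge `DssProfileTruncation` turns it into a rapidly decaying datum whose Leray–Hopf
classical solution has FINITE maximal lifespan `T` (X5a); Clay (A) applied to that datum gives a global
smooth bounded-energy solution, `ClayUniqueness` (X5b) glues it to the blowing-up one on `[0, T)`, and
its restriction to `[0, T+1)` is a smooth extension past `T` — contradicting maximality (the argument
of `Literature.NS.blowup_assembly`, inlined; pure logic, axioms propext/Classical.choice/Quot.sound). -/
@[closes "route-NavierStokesRegularity-QuarterTurnRdss"] theorem closes (hX : QuarterTurnProfileExists) (hDss4 : QuarterTurnRdssIsDss4)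
    (hTrunc : DssProfileTruncation) (hUniq : ClayUniqueness) : ¬ NavierStokesRegularity := by
  intro hA
  obtain ⟨c, hc, R, hR, u, hmild, hmeas, hrdss, hC, hnontriv, -⟩ := hX
  have hdss : Literature.Analysis.FluidPDE.IsDiscretelySelfSimilar (c ^ 4) u :=
    hDss4 c R u (lt_trans zero_lt_one hc) hR hrdss
  have hc4 : 1 < c ^ 4 := one_lt_pow₀ hc (by norm_num)
  obtain ⟨ν, hν, T, hT, v, q, ⟨hcl, hmax⟩, hLH, hdec⟩ :=
    hTrunc ⟨c ^ 4, hc4, u, hmild, hmeas, hdss, hC, hnontriv⟩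
  have h0 : (0 : ℝ) ∈ Set.Ico 0 T := ⟨le_rfl, hT⟩
  obtain ⟨u', p', hu', hp', hns, hbe⟩ :=
    hA ν hν (v 0) (hcl.contDiff_velocity h0) (hcl.divFree 0 h0) hdec
  have heq : ∀ t ∈ Set.Ico 0 T, u' t = v t :=
    hUniq ν hν (v 0) hdec u' v p' q T hT hu' hp' hns hbe hcl hLH rfl
  have hcl' : Literature.Analysis.FluidPDE.IsClassicalNSSolutionOn (Set.Ici 0) ν 0 u' p' :=
    ⟨hu', hp', fun t ht x => hns.momentum t ht x, fun t ht => hns.divFree t ht⟩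
  refine hmax ⟨T + 1, by linarith, u', p', ?_, heq⟩
  exact hcl'.mono (fun t ht => ht.1) (uniqueDiffOn_Ico 0 (T + 1))

end Summit.NavierStokesRegularity.NavierStokesRegularity.Theses.QuarterTurnRdss
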